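import Mathlib.Combinatorics.SimpleGraph.Coloring.Vertex
import Literature.Combinatorics.SimpleGraph.ColourRefinementOrder
import HarnessLib

/-!
# Ordered colour refinement, II: stabilisation and the canonical labelling of CR-discrete graphs

Continuation of `ColourRefinementOrder.lean` (ordered colour refinement `ocr G t : V → ℕ`).

* Stabilisation: the number of colours `ocrClasses G t` is non-decreasing and at most `|V|`,
  strictly increasing at every unstable round, so some round `t ≤ |V| - 1` is stable and then all
  later rounds are (`exists_ocrStable_le`, `OcrStable.succ`, `ocrStable_of_card_le`; Kiefer–McKay
  2020, Cor. 6: `WL₁(n) ≤ n - 1`); at a stable round the classes are those of the stable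
  partition (`ocr_eq_iff_crStable`).
* Hence on a CR-DISCRETE graph (`IsCRDiscrete`, `ColourRefinement.lean`) the colouring `ocr G t`
  is injective as soon as `|V| ≤ t + 1` (`ocr_injective_of_isCRDiscrete`): every vertex has its
  own canonical number, and conversely (`isCRDiscrete_of_ocr_injective`).
* The CANONICAL LABELLING (Immerman–Lander 1990, Thm 1.9.4: graphs with a discrete stable
  colouring are canonised by sorting the colours): `canonRank G t u = #{v | ocr G t v < ocr G t u}`
  is, on a CR-discrete graph on `Fin m` with `m ≤ t + 1`, a permutation of `Fin m`
  (`canonPerm`), and the CANONICAL FORM `canonGraph G t` — vertex `i` adjacent to `j` iff the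
  vertices of ranks `i` and `j` are adjacent — is isomorphic to `G` (`canonGraphIso`), so in
  particular `canonGraph G t` is `k`-colourable iff `G` is (`canonGraph_colorable_iff`). The
  adjacency matrix of `canonGraph G t` is what a symmetric threshold circuit computes
  (`Literature/Computability/Complexity/SymmetricColourRefinement*.lean`).

## References

* [KieferMcKay2020] S. Kiefer, B. D. McKay, *The iteration number of colour refinement*, ICALP
  2020, Def. 3, Cor. 6.
* [ImmermanLander1990] N. Immerman, E. Lander, *Describing graphs: a first-order approach to graph
  canonization* (1990), §1.9, Thm 1.9.4.
* [CaiFurerImmerman1992] Cai–Fürer–Immerman, Combinatorica 12 (1992), §5.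
-/

namespace Literature.Combinatorics.SimpleGraph

open _root_.SimpleGraph Finset

universe u

variable {V : Type u} [Fintype V]

section Rounds

variable {G : _root_.SimpleGraph V} [DecidableRel G.Adj]

/-! ### Stabilisation within `|V| - 1` rounds -/

/-- The number of colours at round `t`. [folklore] -/
def ocrClasses (G : _root_.SimpleGraph V) [DecidableRel G.Adj] (t : ℕ) : ℕ :=
  (univ.image (ocr G t)).card

/-- Round `t` is STABLE: round `t + 1` splits no class of round `t`. [cite: KieferMcKay2020, Def. 3 (stable colouring)] -/
def OcrStable (G : _root_.SimpleGraph V) [DecidableRel G.Adj] (t : ℕ) : Prop :=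
  ∀ u v : V, ocr G (t + 1) u = ocr G (t + 1) v ↔ ocr G t u = ocr G t v

/-- A refinement has at least as many classes, with equality only if it splits nothing: for
`f` refining `g`, `|im g| ≤ |im f|`, and `|im f| ≤ |im g|` forces equal kernels. [folklore] -/
theorem card_image_le_of_refines {f g : V → ℕ} (h : ∀ a b : V, f a = f b → g a = g b) :
    (univ.image g).card ≤ (univ.image f).card ∧
      ((univ.image f).card ≤ (univ.image g).card → ∀ a b : V, g a = g b → f a = f b) := by
  classical
  -- `g` factors through `f` on the image of `f`
  let φ : ℕ → ℕ := fun c => if hc : ∃ a, f a = c then g hc.choose else 0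
  have hφ : ∀ a, φ (f a) = g a := fun a => by
    have hc : ∃ b, f b = f a := ⟨a, rfl⟩
    simp only [φ, dif_pos hc]
    exact h _ _ hc.choose_spec
  have himg : univ.image g = (univ.image f).image φ := by
    ext c
    simp only [mem_image, mem_univ, true_and, exists_exists_eq_and, hφ]
  refine ⟨himg ▸ Finset.card_image_le, fun hle a b hab => ?_⟩
  have hinj : Set.InjOn φ (univ.image f : Finset ℕ) :=
    Finset.card_image_iff.1 (le_antisymm Finset.card_image_le (himg ▸ hle))
  exact hinj (by simp) (by simp) (by rw [hφ, hφ, hab])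

/-- The number of colours is non-decreasing. [cite: KieferMcKay2020, §3] -/
theorem ocrClasses_mono (t : ℕ) : ocrClasses G t ≤ ocrClasses G (t + 1) :=
  (card_image_le_of_refines fun _ _ => ocr_eq_of_succ_eq).1

/-- An unstable round strictly increases the number of colours. [cite: KieferMcKay2020, §3] -/
theorem ocrClasses_lt_of_not_stable {t : ℕ} (h : ¬ OcrStable G t) :
    ocrClasses G t < ocrClasses G (t + 1) := by
  refine lt_of_le_of_ne (ocrClasses_mono t) fun heq => h fun u v => ?_
  exact ⟨ocr_eq_of_succ_eq,
    (card_image_le_of_refines fun _ _ => ocr_eq_of_succ_eq).2 heq.symm.le u v⟩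

/-- The number of colours is at most `|V|`. [folklore] -/
theorem ocrClasses_le_card (t : ℕ) : ocrClasses G t ≤ Fintype.card V :=
  Finset.card_image_le.trans (by rw [Finset.card_univ])

/-- **Once stable, stable forever**: the step depends on the colouring only through its kernel
and the order of its colours, both of which a non-splitting round preserves. [cite: KieferMcKay2020, Def. 3 (stable colouring)] -/
theorem OcrStable.succ {t : ℕ} (h : OcrStable G t) : OcrStable G (t + 1) := by
  intro u v
  have ho : ∀ a b : V, ocr G (t + 1) a < ocr G (t + 1) b ↔ ocr G t a < ocr G t b := by
    intro a b
    constructor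
    · intro hab
      rcases lt_trichotomy (ocr G t a) (ocr G t b) with h' | h' | h'
      · exact h'
      · exact absurd ((h a b).2 h') hab.ne
      · exact absurd hab (not_lt.2 (ocrStep_lt_of_lt h').le)
    · exact fun hab => ocrStep_lt_of_lt hab
  show ocrStep G (ocr G (t + 1)) u = ocrStep G (ocr G (t + 1)) v ↔ _
  rw [← ocrStep_congr (col := ocr G t) (fun a b => (h a b).symm) (fun a b => (ho a b).symm) u,
    ← ocrStep_congr (col := ocr G t) (fun a b => (h a b).symm) (fun a b => (ho a b).symm) v]
  exact Iff.rfl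

/-- Stability persists. [folklore] -/
theorem OcrStable.of_le {s t : ℕ} (h : OcrStable G s) (hst : s ≤ t) : OcrStable G t := by
  induction t, hst using Nat.le_induction with
  | base => exact h
  | succ t _ ih => exact ih.succ

/-- **Stabilisation**: some round `t` with `t + 1 ≤ |V|` (or `t = 0`, for empty `V`) is
stable — the number of colours, at least `1` and at most `|V|`, increases at every unstable
round. [cite: KieferMcKay2020, Cor. 6 (WL₁(n) ≤ n − 1)] -/
theorem exists_ocrStable_le : ∃ t : ℕ, (t + 1 ≤ Fintype.card V ∨ t = 0) ∧ OcrStable G t := by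
  rcases isEmpty_or_nonempty V with hV | hV
  · -- empty graph: round 0 is stable
    exact ⟨0, Or.inr rfl, fun u => (IsEmpty.false u).elim⟩
  by_contra hcon
  push Not at hcon
  -- every round `t ≤ |V| - 1` is unstable, so the number of classes grows by one each round
  have hgrow : ∀ t : ℕ, t + 1 ≤ Fintype.card V → t + ocrClasses G 0 ≤ ocrClasses G t := by
    intro t
    induction t with
    | zero => intro; simp
    | succ t ih =>
      intro ht
      have h1 := ih (by omega)
      have h2 := ocrClasses_lt_of_not_stable (hcon t (Or.inl (by omega)))
      omega
  have h0 : ocrClasses G 0 = 1 := by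
    unfold ocrClasses
    rw [Finset.card_eq_one]
    exact ⟨0, by ext c; simp [eq_comm]⟩
  have hcard : 1 ≤ Fintype.card V := Fintype.card_pos
  have h3 := hgrow (Fintype.card V - 1) (by omega)
  have h4 := ocrClasses_lt_of_not_stable (hcon (Fintype.card V - 1) (Or.inl (by omega)))
  have hle := ocrClasses_le_card (G := G) (Fintype.card V - 1 + 1)
  omega

/-- Hence every round `t` with `|V| ≤ t + 1` is stable. [cite: KieferMcKay2020, Cor. 6 (WL₁(n) ≤ n − 1)] -/
theorem ocrStable_of_card_le {t : ℕ} (ht : Fintype.card V ≤ t + 1) : OcrStable G t := by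
  obtain ⟨s, hs, hstab⟩ := exists_ocrStable_le (G := G)
  exact hstab.of_le (by omega)

/-- At a stable round the colour classes are the classes of the stable partition `crStable`.
[cite: KieferMcKay2020, Def. 3 (stable partition)] -/
theorem ocr_eq_iff_crStable {t : ℕ} (ht : OcrStable G t) (u v : V) :
    ocr G t u = ocr G t v ↔ crStable G u v := by
  constructor
  · intro h i
    rcases le_total i t with hit | hti
    · exact (ocr_eq_iff_crRel i u v).1 (ocr_eq_of_le hit h)
    · -- stable from `t` on
      have : ∀ j, t ≤ j → ocr G j u = ocr G j v := by
        intro j htj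
        induction j, htj using Nat.le_induction with
        | base => exact h
        | succ j hj ih => exact ((ht.of_le hj) u v).2 ih
      exact (ocr_eq_iff_crRel i u v).1 (this i hti)
  · intro h
    exact (ocr_eq_iff_crRel t u v).2 (h t)

/-- **On a CR-discrete graph, ordered colour refinement individualises every vertex**: for
`|V| ≤ t + 1` the colouring `ocr G t` is injective. [cite: ImmermanLander1990, Thm 1.9.4 (proof)] -/
theorem ocr_injective_of_isCRDiscrete (hG : IsCRDiscrete G) {t : ℕ} (ht : Fintype.card V ≤ t + 1) :
    Function.Injective (ocr G t) :=
  fun u v h => hG u v ((ocr_eq_iff_crStable (ocrStable_of_card_le ht) u v).1 h)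

/-- Conversely, if some round is injective the graph is CR-discrete. [folklore] -/
theorem isCRDiscrete_of_ocr_injective {t : ℕ} (h : Function.Injective (ocr G t)) :
    IsCRDiscrete G :=
  fun u v huv => h ((ocr_eq_iff_crRel t u v).2 (huv t))


end Rounds

/-! ## The canonical labelling and the canonical form -/

section Canonical

variable (G : _root_.SimpleGraph V) [DecidableRel G.Adj]

/-- The **canonical rank** of `u` after `t` rounds: the number of vertices with a smaller
round-`t` colour. [cite: ImmermanLander1990, Thm 1.9.4 (proof)] -/
def canonRank (t : ℕ) : V → ℕ := rankOf (ocr G t)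

variable {G}

/-- Unfolding of `canonRank`. [folklore] -/
theorem canonRank_eq (t : ℕ) (u : V) :
    canonRank G t u = (univ.filter fun v => ocr G t v < ocr G t u).card := rfl

/-- Canonical ranks are `< |V|`. [folklore] -/
theorem canonRank_lt_card (t : ℕ) (u : V) : canonRank G t u < Fintype.card V :=
  rankOf_lt_card _ u

/-- Canonical ranks are ordered as colours. [folklore] -/
theorem canonRank_lt_iff (t : ℕ) (u v : V) : canonRank G t u < canonRank G t v ↔ ocr G t u < ocr G t v :=
  rankOf_lt_iff _

/-- Canonical ranks are equal iff colours are. [folklore] -/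
theorem canonRank_eq_iff (t : ℕ) (u v : V) : canonRank G t u = canonRank G t v ↔ ocr G t u = ocr G t v :=
  rankOf_eq_iff _

/-- **On a CR-discrete graph the canonical rank is injective** once `|V| ≤ t + 1`. [cite: ImmermanLander1990, Thm 1.9.4 (proof)] -/
theorem canonRank_injective (hG : IsCRDiscrete G) {t : ℕ} (ht : Fintype.card V ≤ t + 1) :
    Function.Injective (canonRank G t) :=
  rankOf_injective _ (ocr_injective_of_isCRDiscrete hG ht)

/-- The **canonical adjacency relation** on rank values: `i ~ j` iff the vertices of canonical
ranks `i` and `j` are adjacent. [cite: ImmermanLander1990, Thm 1.9.4 (canonical labelling)] -/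
def CanonAdj (G : _root_.SimpleGraph V) [DecidableRel G.Adj] (t : ℕ) (i j : ℕ) : Prop :=
  ∃ u v : V, canonRank G t u = i ∧ canonRank G t v = j ∧ G.Adj u v

/-- `CanonAdj` is symmetric. [folklore] -/
theorem CanonAdj.symm {t i j : ℕ} (h : CanonAdj G t i j) : CanonAdj G t j i := by
  obtain ⟨u, v, hu, hv, huv⟩ := h
  exact ⟨v, u, hv, hu, huv.symm⟩

end Canonical

section Fin

variable {m : ℕ} (G : _root_.SimpleGraph (Fin m)) [DecidableRel G.Adj]

/-- The **canonical form** of a graph on `Fin m` after `t` rounds: the graph on `Fin m` in which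
`i ~ j` iff the vertices of canonical ranks `i` and `j` are adjacent (read as a simple graph
through `SimpleGraph.fromRel`, the tree's decoding of Boolean matrices). [cite: ImmermanLander1990, Thm 1.9.4 (canonical labelling)] -/
def canonGraph (t : ℕ) : _root_.SimpleGraph (Fin m) :=
  _root_.SimpleGraph.fromRel fun i j : Fin m => CanonAdj G t i j

variable {G}

/-- The canonical rank as a map `Fin m → Fin m`. [folklore] -/
def canonRankFin (t : ℕ) (u : Fin m) : Fin m :=
  ⟨canonRank G t u, by simpa using canonRank_lt_card (G := G) t u⟩

/-- Its value. [folklore] -/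
@[simp] theorem coe_canonRankFin (t : ℕ) (u : Fin m) : (canonRankFin (G := G) t u : ℕ) = canonRank G t u :=
  rfl

/-- An injective canonical rank is a bijection of `Fin m`. [folklore] -/
theorem canonRankFin_bijective {t : ℕ} (h : Function.Injective (canonRank G t)) :
    Function.Bijective (canonRankFin (G := G) t) :=
  Finite.injective_iff_bijective.1 fun u v huv => h (by simpa using congrArg Fin.val huv)

/-- **The canonical labelling**: on a CR-discrete graph (indeed whenever the canonical rank is
injective) the canonical rank is a permutation of `Fin m`. [cite: ImmermanLander1990, Thm 1.9.4 (canonical labelling)] -/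
noncomputable def canonPerm (t : ℕ) (h : Function.Injective (canonRank G t)) : Equiv.Perm (Fin m) :=
  Equiv.ofBijective _ (canonRankFin_bijective h)

/-- The canonical labelling sends `u` to its rank. [folklore] -/
@[simp] theorem coe_canonPerm_apply {t : ℕ} (h : Function.Injective (canonRank G t)) (u : Fin m) :
    (canonPerm t h u : ℕ) = canonRank G t u := rfl

/-- Adjacency in the canonical form, for an injective canonical rank: ranks `i ~ j` iff their
vertices are adjacent. [folklore] -/
theorem canonAdj_iff {t : ℕ} (h : Function.Injective (canonRank G t)) (i j : Fin m) :
    CanonAdj G t i j ↔ G.Adj ((canonPerm t h).symm i) ((canonPerm t h).symm j) := by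
  constructor
  · rintro ⟨u, v, hu, hv, huv⟩
    have hu' : canonPerm t h u = i := Fin.ext hu
    have hv' : canonPerm t h v = j := Fin.ext hv
    rw [← hu', ← hv', Equiv.symm_apply_apply, Equiv.symm_apply_apply]
    exact huv
  · intro hadj
    refine ⟨(canonPerm t h).symm i, (canonPerm t h).symm j, ?_, ?_, hadj⟩
    · have := coe_canonPerm_apply h ((canonPerm t h).symm i)
      rw [Equiv.apply_symm_apply] at this
      exact this.symm
    · have := coe_canonPerm_apply h ((canonPerm t h).symm j)
      rw [Equiv.apply_symm_apply] at this
      exact this.symm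

/-- Adjacency in the canonical form graph. [folklore] -/
theorem canonGraph_adj_iff {t : ℕ} (h : Function.Injective (canonRank G t)) (i j : Fin m) :
    (canonGraph G t).Adj i j ↔ G.Adj ((canonPerm t h).symm i) ((canonPerm t h).symm j) := by
  rw [canonGraph, _root_.SimpleGraph.fromRel_adj, canonAdj_iff h, canonAdj_iff h]
  constructor
  · rintro ⟨-, h' | h'⟩
    · exact h'
    · exact h'.symm
  · intro h'
    exact ⟨fun hij => by subst hij; exact G.irrefl h', Or.inl h'⟩

/-- **The canonical form is isomorphic to the graph** (along the canonical labelling).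
[cite: ImmermanLander1990, Thm 1.9.4 (canonical labelling)] -/
noncomputable def canonGraphIso (t : ℕ) (h : Function.Injective (canonRank G t)) :
    canonGraph G t ≃g G where
  toEquiv := (canonPerm t h).symm
  map_rel_iff' := fun {i j} => (canonGraph_adj_iff h i j).symm

/-- Hence **the canonical form is `k`-colourable iff the graph is**. [folklore] -/
theorem canonGraph_colorable_iff {t : ℕ} (h : Function.Injective (canonRank G t)) (k : ℕ) :
    (canonGraph G t).Colorable k ↔ G.Colorable k :=
  ⟨fun hc => hc.of_hom (canonGraphIso t h).symm.toHom, fun hc => hc.of_hom (canonGraphIso t h).toHom⟩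

/-- In particular on a CR-discrete graph on `Fin m`, for `m ≤ t + 1`. [cite: ImmermanLander1990, Thm 1.9.4 (canonical labelling)] -/
theorem canonGraph_colorable_iff_of_isCRDiscrete (hG : IsCRDiscrete G) {t : ℕ} (ht : m ≤ t + 1)
    (k : ℕ) : (canonGraph G t).Colorable k ↔ G.Colorable k :=
  canonGraph_colorable_iff (canonRank_injective hG (by simpa using ht)) k

end Fin

end Literature.Combinatorics.SimpleGraph
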